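import Mathlib
import Summits.Ventures.HodgeRepro2.T6NAut
import Summits.Ventures.HodgeRepro2.T6N2Datum
import Summits.Ventures.HodgeRepro2.T6NAut2

/-!
# T6NAut3 — the automorphic datum `NAut3 F P`: the v2 carrier with its richness RE-CUT (TARGET-T6 v0.6 §9.2(b), v3)

Cell pub-hodge-repro2, Tier 6 (README §10), seat t6-lead (gen 4). Version 3 of the M2 carrier. What
changes and why: t6-p1's `T6N1Obstruction` (p406480, STATUS l. 11204 (1)–(2)) proves, kernel-checked,
that v1's richness `data_surj` («EVERY quadruple of Schwartz data is realised by an admissible choice»)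
is jointly inconsistent with the four N1 displays on any carrier whose N3 side has one quadruple with
non-zero pairing: the period `I_σ(c)` ranges over a countable c-independent set while `data_surj`
realises every ℂ-scaling `(t • φ_a, φ_b, φ_c, φ_d)` and Liu's identification `I = c_K ⟨F_A, F_B⟩`
then forces `±c_K · t · v` into that set for every `t : ℂ`. v2's `data_adm` (T6NAut2, p402224) is
restricted to the N2-admissible sets `admA … admD` and is not refuted as such, but it still promises
the REALISATION of every admissible quadruple by its Schwartz data — more than the M2 composition
ever consumes. The composition uses richness ONLY through `exists_choice_of_pairing_ne_zero`
(«an N2-admissible quadruple with non-zero pairing gives an admissible choice with non-zero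
pairing»), so v3 carries exactly that as its field `data_adm'`: no scaling, no zero datum, no equality
of Schwartz data is promised — the print's identification holds for the NORMALISED data of
TIER5 B7(b) / Lemma A7.3(b), and the normalisation is now the instance's business (`AdmChoice`).

Everything else is v2 verbatim (same field names; the owners' side-level statements — N1 on `d1`,
N3 on `d3`, N4 on `sA` / `sB`, N5 on `d5` — read the same). A v2 carrier is a v3 carrier
(`NAut3.ofNAut2`), and a v1 carrier with an N2 datum adjoined is one too (`NAut3.ofNAut`); there is
no map back. The declared M2 object (v4, `periodInputN_of_published₄`, STATUS l. 11086) stays on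
v2; the v5 re-stage (l. 11168) moves to v3 as `periodInputN_of_published₆` (this seat's successor).

§8(d): uses an L-value-free non-vanishing device: NO.
-/

namespace Summit.Ventures.HodgeRepro2.T6

open scoped InnerProductSpace

variable {K : Type*} [Field K] [NumberField K] [NumberField.IsCMField K]

/-- THE AUTOMORPHIC DATUM OF THE M2 COMPOSITION, v3: the owners' datum types plus the N2 datum, with
the richness of the choice dictionary RE-CUT to what the composition consumes (`data_adm'`). -/
structure NAut3 (F : FaceSetting K) (P : NDatum F) where
  /-- the N3 datum (t6-p3, `T6N3Datum`): `L²([G])`, `G(𝔸_f)`, the two sides `A` and `B` with their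
  Schwartz spaces, theta lifts and toric periods -/
  d3 : N3Datum
  /-- the Schwartz data of a choice `c` of the period datum: `(φ_a, φ_b)` on side A and `(φ_c, φ_d)`
  on side B (t6-p3's choice dictionary, STATUS l. 4764 (3)) -/
  data : P.Choice → d3.A.Sa × d3.A.Sb × d3.B.Sa × d3.B.Sb
  /-- the N2 datum (t6-p5, `T6N2Datum`): the CM frame `τ`, the sign elements `e₁₁₁`, `e₁₀₀`, the
  similitude scalar `u`, the characters, and the admissible sets `admA … admD` of Schwartz data -/
  d2 : N2Datum F P d3
  /-- `[compat: owners t6-lead, t6-p5, t6-p3; discharged at: B7(b) / Lemma A7.3(b) on the host]`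
  CONDITIONAL RICHNESS, v3 (re-cut after t6-p1's `T6N1Obstruction`, p406480): under N2's datum-level
  admissibility, an N2-admissible quadruple of Schwartz data with non-zero pairing
  `⟨F_A(φ_a, φ_b), F_B(φ_c, φ_d)⟩` is matched by an admissible choice `c` whose own Schwartz data have
  non-zero pairing — nothing about the data of `c` beyond that is promised -/
  data_adm' : d2.Adm → ∀ (φa : d3.A.Sa) (φb : d3.A.Sb) (φc : d3.B.Sa) (φd : d3.B.Sb),
    d2.AdmData (φa, φb, φc, φd) → ⟪d3.B.F φc φd, d3.A.F φa φb⟫_ℂ ≠ 0 →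
    ∃ c, P.AdmChoice c ∧ ⟪d3.B.F (data c).2.2.1 (data c).2.2.2, d3.A.F (data c).1 (data c).2.1⟫_ℂ ≠ 0
  /-- the N1 datum (t6-p1, `T6N1Datum`) in N3's parameter shape: `LG = L²([G])`,
  `F_A c = F_A(φ_a, φ_b) = η_a η_b`, `F_B c = F_B(φ_c, φ_d) = η_{c̄} η_{d̄}` at the Schwartz data of `c` -/
  d1 : N1Datum F P d3.LG (fun c => d3.A.F (data c).1 (data c).2.1)
    (fun c => d3.B.F (data c).2.2.1 (data c).2.2.2)
  /-- the N4 data of side A (`π₀` on `W_A = W₁₂`) -/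
  sA : NSide
  /-- the N4 data of side B (`π₀′` on `W_B = W₃₄`) -/
  sB : NSide
  /-- the index type of the toric data of N5 -/
  ι5 : Type
  /-- the (abelian) torus of N5 -/
  G5 : Type
  [instG5 : CommGroup G5]
  /-- the N5 datum (t6-p7, `T6N5Skeleton`): the two toric sides with the same `β` and the same
  splitting character `f` -/
  d5 : N5Skeleton.N5Data ι5 G5
  /-- `[compat: owners t6-p3, t6-p7; discharged at: residual IR]` N5's conclusion on side A is
  Proposition N*'s hypothesis (ii) for side A in N3's words (`N3Side.hypII`) -/
  hypII_A_of_N5 : d5.A.levelPeriodNonzero → d3.A.hypII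
  /-- `[compat: owners t6-p3, t6-p7; discharged at: residual IR]` the same on side B -/
  hypII_B_of_N5 : d5.B.levelPeriodNonzero → d3.B.hypII

namespace NAut3

variable {F : FaceSetting K} {P : NDatum F} (M : NAut3 F P)

/-- the group structure of the N5 torus (field) -/
instance : CommGroup M.G5 := M.instG5

/-- N2's conclusion for the carrier (`N2_main`'s target): the datum is μ-admissible, `W_B ≅ W_A`,
and (H_χ) holds — `N2Datum.Adm` of the N2 datum. -/
def AdmDatum : Prop := M.d2.Adm

/-- The admissible quadruples of Schwartz data (`N2Datum.AdmData` of the N2 datum). -/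
def AdmData (φ : M.d3.A.Sa × M.d3.A.Sb × M.d3.B.Sa × M.d3.B.Sb) : Prop := M.d2.AdmData φ

/-- Proposition N*'s hypothesis (i) for side A (`N3Side.hypI`). -/
def iA : Prop := M.d3.A.hypI

/-- (i) for side B. -/
def iB : Prop := M.d3.B.hypI

/-- Proposition N*'s hypothesis (ii) for side A (`N3Side.hypII`). -/
def iiA : Prop := M.d3.A.hypII

/-- (ii) for side B. -/
def iiB : Prop := M.d3.B.hypII

/-- Proposition N*'s conclusion for side A: `ℓ_A ≠ 0` (`N3Datum.ellNonzero`). -/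
def ellA : Prop := M.d3.ellNonzero M.d3.A

/-- Proposition N*'s conclusion for side B: `ℓ_B ≠ 0`. -/
def ellB : Prop := M.d3.ellNonzero M.d3.B

/-- N1's pairing `⟨F_A, F_B⟩ = ∫_{[G]} F_A \overline{F_B}` at the choice `c`, in N3's vocabulary
(Mathlib's `⟪x, y⟫_ℂ` is conjugate-linear in `x`: the record's `⟨a, b⟩` is `⟪b, a⟫_ℂ`). -/
noncomputable def pairing (c : P.Choice) : ℂ :=
  ⟪M.d3.B.F (M.data c).2.2.1 (M.data c).2.2.2, M.d3.A.F (M.data c).1 (M.data c).2.1⟫_ℂ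

/-- `NAut3.pairing` is the N1 datum's pairing. -/
theorem pairing_eq (c : P.Choice) : M.pairing c = M.d1.pairing c := rfl

/-- THE ISOTYPIC STEP OF N3 IN THE CHOICE FORM, v3 — N2 LOAD-BEARING: under N2's datum-level
admissibility, if some N2-ADMISSIBLE quadruple of Schwartz data `(φ_a, φ_b, φ_c, φ_d)` has a non-zero
pairing `⟨F_A(φ_a, φ_b), F_B(φ_c, φ_d)⟩` (the v2 isotypic statement `N3iso_main₂`), then some
admissible choice `c` of the period datum has `pairing c ≠ 0` — this IS the field `data_adm'`. -/
theorem exists_choice_of_pairing_ne_zero (hN2 : M.AdmDatum)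
    (h : ∃ (φa : M.d3.A.Sa) (φb : M.d3.A.Sb) (φc : M.d3.B.Sa) (φd : M.d3.B.Sb),
      M.AdmData (φa, φb, φc, φd) ∧ ⟪M.d3.B.F φc φd, M.d3.A.F φa φb⟫_ℂ ≠ 0) :
    ∃ c, P.AdmChoice c ∧ M.pairing c ≠ 0 := by
  obtain ⟨φa, φb, φc, φd, hadm, hne⟩ := h
  exact M.data_adm' hN2 φa φb φc φd hadm hne

/-- N4's conclusion for both sides in N4.1's words. -/
def N4 : Prop := M.sA.R1AndHloc ∧ M.sB.R1AndHloc

/-- N5's conclusion (t6-p7's `N5Data.N5`): both toric periods are non-zero on the level parts. -/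
def N5 : Prop := M.d5.N5

/-- N5 gives Proposition N*'s hypotheses (ii) on both sides, through the compat fields. -/
theorem iiA_and_iiB_of_N5 (h : M.N5) : M.iiA ∧ M.iiB :=
  ⟨M.hypII_A_of_N5 h.1, M.hypII_B_of_N5 h.2⟩

/-- A v1 carrier with an N2 datum adjoined is a v3 carrier: v1's unconditional richness gives the
re-cut one. (No map back.) -/
def ofNAut (M₁ : NAut F P) (d2 : N2Datum F P M₁.d3) : NAut3 F P where
  d3 := M₁.d3
  data := M₁.data
  d2 := d2
  data_adm' _ φa φb φc φd _ hne := by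
    obtain ⟨c, hc, hd⟩ := M₁.data_surj φa φb φc φd
    exact ⟨c, hc, by rw [hd]; exact hne⟩
  d1 := M₁.d1
  sA := M₁.sA
  sB := M₁.sB
  ι5 := M₁.ι5
  G5 := M₁.G5
  instG5 := M₁.instG5
  d5 := M₁.d5
  hypII_A_of_N5 := M₁.hypII_A_of_N5
  hypII_B_of_N5 := M₁.hypII_B_of_N5

/-- `ofNAut` keeps the pairing. -/
theorem ofNAut_pairing (M₁ : NAut F P) (d2 : N2Datum F P M₁.d3) (c : P.Choice) :
    (ofNAut M₁ d2).pairing c = M₁.pairing c := rfl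

/-- A v2 carrier is a v3 carrier: v2's realisation of every admissible quadruple gives, for a
quadruple with non-zero pairing, a choice whose data have that pairing. (No map back.) -/
def ofNAut2 (M₂ : NAut2 F P) : NAut3 F P where
  d3 := M₂.d3
  data := M₂.data
  d2 := M₂.d2
  data_adm' h φa φb φc φd hadm hne := by
    obtain ⟨c, hc, hd⟩ := M₂.data_adm h φa φb φc φd hadm
    exact ⟨c, hc, by rw [hd]; exact hne⟩
  d1 := M₂.d1
  sA := M₂.sA
  sB := M₂.sB
  ι5 := M₂.ι5
  G5 := M₂.G5
  instG5 := M₂.instG5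
  d5 := M₂.d5
  hypII_A_of_N5 := M₂.hypII_A_of_N5
  hypII_B_of_N5 := M₂.hypII_B_of_N5

/-- `ofNAut2` keeps the pairing. -/
theorem ofNAut2_pairing (M₂ : NAut2 F P) (c : P.Choice) :
    (ofNAut2 M₂).pairing c = M₂.pairing c := rfl

/-- `ofNAut2` keeps the N2 conclusion. -/
theorem ofNAut2_admDatum (M₂ : NAut2 F P) : (ofNAut2 M₂).AdmDatum ↔ M₂.AdmDatum := Iff.rfl

end NAut3

/-- THE M2 COMPOSITION, v3 — the logic over `NAut3` with N2 as a binder: from N1, N2 (`M.AdmDatum`),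
N3 on both sides with the isotypic step IN ITS DATA FORM (an N2-admissible quadruple with non-zero
pairing), N4 and N5 — an admissible choice `c` with `Hyp.PeriodN (P.shadow c)`. `hN2` is consumed
in the passage from the admissible quadruple to the admissible choice. -/
theorem periodInputN_of_mains₃ {F : FaceSetting K} (P : NDatum F) (M : NAut3 F P)
    (hN1 : ∀ c, P.AdmChoice c → M.pairing c ≠ 0 → P.I P.τ₁ c ≠ 0)
    (hN2 : M.AdmDatum)
    (hN3A : M.iA → M.iiA → M.ellA) (hN3B : M.iB → M.iiB → M.ellB)
    (hN3iso : M.ellA → M.ellB → ∃ (φa : M.d3.A.Sa) (φb : M.d3.A.Sb) (φc : M.d3.B.Sa) (φd : M.d3.B.Sb),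
      M.AdmData (φa, φb, φc, φd) ∧ ⟪M.d3.B.F φc φd, M.d3.A.F φa φb⟫_ℂ ≠ 0)
    (hN4 : M.iA ∧ M.iB) (hN5 : M.N5) :
    ∃ c, P.AdmChoice c ∧ Hyp.PeriodN (P.shadow c) := by
  obtain ⟨hiiA, hiiB⟩ := M.iiA_and_iiB_of_N5 hN5
  obtain ⟨c, hc, hp⟩ :=
    M.exists_choice_of_pairing_ne_zero hN2 (hN3iso (hN3A hN4.1 hiiA) (hN3B hN4.2 hiiB))
  exact ⟨c, hc, P.periodN_of_I_ne_zero (hN1 c hc hp)⟩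

end Summit.Ventures.HodgeRepro2.T6
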